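import Literature.NumberTheory.LFunctions.KloostermanFractionsAmplifiedForm
import Literature.NumberTheory.Sieve.DivisorBound
import HarnessLib

/-!
# Bilinear forms with Kloosterman fractions: removing the square-free condition (Bettin–Chandee §6)

Topic `NumberTheory/LFunctions`.  S. Bettin, V. Chandee, *Trilinear forms with Kloosterman
fractions*, Adv. Math. 328 (2018), §6 "Removing the square-free condition": "We write `n = bn'`,
where `n'` is square-free, `b` is square-full, and `(b, n') = 1`.  We have
`|∑_a ∑_{n,(m,n)=1} β_n ν_a e(ϑam̄/n)|² = |∑_{b, b square-full} ∑_a ∑_{bn',(bϑm,n')=1, n' square-free} β_{bn'} ν_a e(…)|²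
 ≪ (∑_b b^{-1/2})(∑_b b^{1/2} |∑_a ∑_{n'} μ(n')² β_{bn'} ν_a e(…)|²)`… Thus
`𝓒₁(M,N,A;β,ν) ≪ ∑_{b, (b,ϑ)=1, b square-full} b^{1/2} 𝓒_b(M, N/b, A; β_b, ν)` where
`β_b(n) := μ(n)² β_{bn}`."  This file PROVES that step (single numerator `A = 1`), for an
ARBITRARY phase `φ(m, n)` (so that it serves the untwisted second moment `kfC` of the tree and the
twisted one of Remark 2 alike), together with the bound for the number of squarefull integers it
needs:

* `sqfullPart`, `sqfreePart` — the decomposition `n = b n'` (`factorization`-based definitions),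
  with `sqfullPart_mul_sqfreePart`, `coprime_sqfullPart_sqfreePart`, `squarefree_sqfreePart`,
  `sq_dvd_sqfullPart`, and uniqueness `sqfullPart_eq_of_decomposition`;
* `sum_Icc_eq_sum_sqfullPart_fiber`, `sum_sqfullPart_fiber_eq` — regrouping `∑_{n ≤ X}` by `b`,
  the fibre being `{b n' : n' ≤ X/b, μ²(n') = 1, (n', b) = 1}`;
* `norm_sum_sq_le_weighted` — Cauchy–Schwarz with weights; `BC_norm_sum_sq_le_sqfull` — the
  displayed inequality with weights `b^{1/2}`;
* **`BC_second_moment_le_sqfull`** — `∑_{m ≤ Y}|∑_{n ≤ X,(m,n)=1} β_n φ(m,n)|²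
  ≤ Z(X) ∑_{b sqfull} b^{1/2} ∑_{m,(m,b)=1} |∑_{n' ≤ X/b,(n',m)=1} β_b(n') φ(m,bn')|²`,
  `β_b(n') = μ²(n')[(n',b)=1] β_{bn'}`, `Z(X) = ∑_{b ≤ X sqfull} b^{-1/2}`;
* `exists_sq_mul_dvd_of_sqfull` (`b` squarefull ⟹ `b = d²a`, `a ∣ d`) and
  **`sum_sqfull_inv_sqrt_le`**: `Z(X) ≤ C_ε X^ε` (the source's "`M^ε`");
* **`BC_C1_le_sum_sqfull_kfC`** — the specialisation to the tree's `kfC`: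
  `𝓒₁ ≤ Z(⌊2N⌋) ∑_b b^{1/2} kfC k b M (N/b) β_b`; `BC_C1_twisted_le_sum_sqfull` — the twisted phase.

The condition `(b, ϑ) = 1` of the source is automatic once `β` is supported on `(n, ϑ) = 1`
(then `β_b = 0` unless `(b, ϑ) = 1`); it is not imposed here.

## References

* S. Bettin, V. Chandee, Adv. Math. 328 (2018) 1234–1262 (arXiv:1502.00769), §6.
  [BettinChandee2018]
* W. Duke, J. Friedlander, H. Iwaniec, Invent. Math. 128 (1997) 23–43. [DukeFriedlanderIwaniec1997]
-/

noncomputable section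

open Finset

namespace Literature.NumberTheory.LFunctions

/-! ### The squarefull and squarefree parts of an integer -/

/-- The **squarefull part** of `n`: `∏_{p² ∣ n} p^{v_p(n)}` (Bettin–Chandee §6: "we write `n = b n'`
where `n'` is square-free, `b` is square-full and `(b, n') = 1`"; this is `b`). For `n = 0` it is `1`.
[cite: BettinChandee2018, §6] -/
def sqfullPart (n : ℕ) : ℕ :=
  (n.factorization.filter (fun p => 2 ≤ n.factorization p)).prod (· ^ ·)

/-- The **squarefree part** of `n` in the sense of Bettin–Chandee §6: `∏_{p ∥ n} p`, the product of
the primes dividing `n` exactly once (this is `n'` in `n = b n'`). For `n = 0` it is `1`.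
[cite: BettinChandee2018, §6] -/
def sqfreePart (n : ℕ) : ℕ :=
  (n.factorization.filter (fun p => n.factorization p = 1)).prod (· ^ ·)

/-- `v_p` of the squarefull part: `v_p(n)` if `v_p(n) ≥ 2`, else `0`. [folklore] -/
theorem factorization_sqfullPart (n : ℕ) :
    (sqfullPart n).factorization = n.factorization.filter (fun p => 2 ≤ n.factorization p) := by
  unfold sqfullPart
  refine Nat.prod_pow_factorization_eq_self fun p hp => ?_
  rw [Finsupp.support_filter, Finset.mem_filter] at hp
  exact Nat.prime_of_mem_primeFactors hp.1

/-- `v_p` of the squarefree part: `1` if `v_p(n) = 1`, else `0`. [folklore] -/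
theorem factorization_sqfreePart (n : ℕ) :
    (sqfreePart n).factorization = n.factorization.filter (fun p => n.factorization p = 1) := by
  unfold sqfreePart
  refine Nat.prod_pow_factorization_eq_self fun p hp => ?_
  rw [Finsupp.support_filter, Finset.mem_filter] at hp
  exact Nat.prime_of_mem_primeFactors hp.1

/-- The squarefull part is positive. [folklore] -/
theorem sqfullPart_pos (n : ℕ) : 0 < sqfullPart n := by
  unfold sqfullPart
  rw [Finsupp.prod]
  refine Finset.prod_pos fun p hp => pow_pos ?_ _
  rw [Finsupp.support_filter, Finset.mem_filter] at hp
  exact (Nat.prime_of_mem_primeFactors hp.1).pos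

/-- The squarefree part is positive. [folklore] -/
theorem sqfreePart_pos (n : ℕ) : 0 < sqfreePart n := by
  unfold sqfreePart
  rw [Finsupp.prod]
  refine Finset.prod_pos fun p hp => pow_pos ?_ _
  rw [Finsupp.support_filter, Finset.mem_filter] at hp
  exact (Nat.prime_of_mem_primeFactors hp.1).pos

/-- `n = (squarefull part) · (squarefree part)` for `n ≥ 1`. [cite: BettinChandee2018, §6] -/
theorem sqfullPart_mul_sqfreePart {n : ℕ} (hn : n ≠ 0) : sqfullPart n * sqfreePart n = n := by
  apply Nat.eq_of_factorization_eq (Nat.mul_ne_zero (sqfullPart_pos n).ne' (sqfreePart_pos n).ne') hn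
  intro p
  rw [Nat.factorization_mul (sqfullPart_pos n).ne' (sqfreePart_pos n).ne', Finsupp.add_apply,
    factorization_sqfullPart, factorization_sqfreePart, Finsupp.filter_apply, Finsupp.filter_apply]
  by_cases h0 : n.factorization p = 0
  · simp [h0]
  · by_cases h1 : n.factorization p = 1
    · simp [h1]
    · have h2 : 2 ≤ n.factorization p := by omega
      simp [h1, h2]

/-- The two parts are coprime. [cite: BettinChandee2018, §6] -/
theorem coprime_sqfullPart_sqfreePart (n : ℕ) : (sqfullPart n).Coprime (sqfreePart n) := by
  rw [← Nat.disjoint_primeFactors (sqfullPart_pos n).ne' (sqfreePart_pos n).ne',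
    ← Nat.support_factorization, ← Nat.support_factorization, factorization_sqfullPart,
    factorization_sqfreePart, Finsupp.support_filter, Finsupp.support_filter]
  rw [Finset.disjoint_filter]
  intro p _ h2 h1
  omega

/-- The squarefree part is squarefree. [cite: BettinChandee2018, §6] -/
theorem squarefree_sqfreePart (n : ℕ) : Squarefree (sqfreePart n) := by
  rw [Nat.squarefree_iff_factorization_le_one (sqfreePart_pos n).ne']
  intro p
  rw [factorization_sqfreePart, Finsupp.filter_apply]
  split_ifs with h
  · exact h.le
  · exact zero_le_one

/-- The squarefull part is squarefull: `p ∣ b ⟹ p² ∣ b`. [cite: BettinChandee2018, §6] -/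
theorem sq_dvd_sqfullPart {n p : ℕ} (hp : p ∈ (sqfullPart n).primeFactors) : p ^ 2 ∣ sqfullPart n := by
  have hpp := Nat.prime_of_mem_primeFactors hp
  rw [hpp.pow_dvd_iff_le_factorization (sqfullPart_pos n).ne', factorization_sqfullPart,
    Finsupp.filter_apply]
  rw [← Nat.support_factorization, factorization_sqfullPart, Finsupp.support_filter,
    Finset.mem_filter] at hp
  rw [if_pos hp.2]
  exact hp.2

/-- The squarefull part divides `n`. [folklore] -/
theorem sqfullPart_dvd (n : ℕ) : sqfullPart n ∣ n := by
  rcases eq_or_ne n 0 with rfl | hn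
  · exact dvd_zero _
  · exact Dvd.intro _ (sqfullPart_mul_sqfreePart hn)

/-- **Uniqueness of the decomposition**: if `n = b n'` with `b` squarefull, `n'` squarefree and
`(b, n') = 1`, then `b` is the squarefull part of `n` (and `n'` the squarefree part).
[cite: BettinChandee2018, §6] -/
theorem sqfullPart_eq_of_decomposition {b n' : ℕ} (hb : 0 < b) (hn' : 0 < n')
    (hbfull : ∀ p ∈ b.primeFactors, p ^ 2 ∣ b) (hsq : Squarefree n') (hcop : b.Coprime n') :
    sqfullPart (b * n') = b := by
  have hn : b * n' ≠ 0 := Nat.mul_ne_zero hb.ne' hn'.ne'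
  apply Nat.eq_of_factorization_eq (sqfullPart_pos _).ne' hb.ne'
  intro p
  rw [factorization_sqfullPart, Finsupp.filter_apply, Nat.factorization_mul hb.ne' hn'.ne',
    Finsupp.add_apply]
  have hsq' := (Nat.squarefree_iff_factorization_le_one hn'.ne').mp hsq p
  by_cases hpb : p ∈ b.primeFactors
  · -- `p ∣ b`: `v_p(b) ≥ 2`, `v_p(n') = 0`
    have hpp := Nat.prime_of_mem_primeFactors hpb
    have h2 : 2 ≤ b.factorization p :=
      (hpp.pow_dvd_iff_le_factorization hb.ne').mp (hbfull p hpb)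
    have h0 : n'.factorization p = 0 := by
      apply Nat.factorization_eq_zero_of_not_dvd
      intro hpn'
      have := Finset.disjoint_left.mp hcop.disjoint_primeFactors hpb
      exact this (Nat.mem_primeFactors.mpr ⟨hpp, hpn', hn'.ne'⟩)
    rw [h0, add_zero, if_pos h2]
  · have h0 : b.factorization p = 0 := by
      rw [← Nat.support_factorization, Finsupp.mem_support_iff, not_not] at hpb
      exact hpb
    rw [h0, zero_add]
    have : ¬ (2 ≤ n'.factorization p) := by omega
    rw [if_neg this]

/-- In the decomposition `n = b n'`, `n' = n / b` is the squarefree part. [folklore] -/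
theorem sqfreePart_eq_div {n : ℕ} (hn : n ≠ 0) : sqfreePart n = n / sqfullPart n := by
  have h := sqfullPart_mul_sqfreePart hn
  have h2 : n / sqfullPart n = sqfullPart n * sqfreePart n / sqfullPart n := by rw [h]
  rw [h2, Nat.mul_div_cancel_left _ (sqfullPart_pos n)]

/-! ### Regrouping a sum by the squarefull part -/

/-- **Regrouping by the squarefull part**: `∑_{n ≤ X} c(n) = ∑_{b ≤ X squarefull} ∑_{n ≤ X, b(n) = b} c(n)`.
[cite: BettinChandee2018, §6] -/
theorem sum_Icc_eq_sum_sqfullPart_fiber {E : Type*} [AddCommMonoid E] (X : ℕ) (c : ℕ → E) :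
    ∑ n ∈ Icc 1 X, c n =
      ∑ b ∈ (Icc 1 X).filter (fun b => ∀ p ∈ b.primeFactors, p ^ 2 ∣ b),
        ∑ n ∈ (Icc 1 X).filter (fun n => sqfullPart n = b), c n := by
  symm
  apply Finset.sum_fiberwise_of_maps_to
  intro n hn
  rw [Finset.mem_Icc] at hn
  rw [Finset.mem_filter, Finset.mem_Icc]
  refine ⟨⟨sqfullPart_pos n, ?_⟩, fun p hp => sq_dvd_sqfullPart hp⟩
  exact (Nat.le_of_dvd (by omega) (sqfullPart_dvd n)).trans hn.2

/-- **The fibre of the squarefull part**: for `b` squarefull,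
`∑_{n ≤ X, b(n) = b} c(n) = ∑_{n' ≤ X/b, n' squarefree, (n',b)=1} c(b n')` (uniqueness of the
decomposition `n = b n'`). [cite: BettinChandee2018, §6] -/
theorem sum_sqfullPart_fiber_eq {E : Type*} [AddCommMonoid E] (X : ℕ) {b : ℕ} (hb : 0 < b)
    (hbfull : ∀ p ∈ b.primeFactors, p ^ 2 ∣ b) (c : ℕ → E) :
    ∑ n ∈ (Icc 1 X).filter (fun n => sqfullPart n = b), c n =
      ∑ n' ∈ (Icc 1 (X / b)).filter (fun n' => Squarefree n' ∧ n'.Coprime b), c (b * n') := by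
  refine Finset.sum_nbij' (fun n => n / b) (fun n' => b * n') ?_ ?_ ?_ ?_ ?_
  · intro n hn
    rw [Finset.mem_filter, Finset.mem_Icc] at hn
    obtain ⟨⟨h1, h2⟩, hbn⟩ := hn
    have hn0 : n ≠ 0 := by omega
    have hn' : n / b = sqfreePart n := by rw [sqfreePart_eq_div hn0, hbn]
    rw [Finset.mem_filter, Finset.mem_Icc, hn']
    refine ⟨⟨sqfreePart_pos n, ?_⟩, squarefree_sqfreePart n, ?_⟩
    · rw [← hn']; exact Nat.div_le_div_right h2
    · rw [← hbn]; exact (coprime_sqfullPart_sqfreePart n).symm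
  · intro n' hn'
    rw [Finset.mem_filter, Finset.mem_Icc] at hn'
    obtain ⟨⟨h1, h2⟩, hsq, hcop⟩ := hn'
    rw [Finset.mem_filter, Finset.mem_Icc]
    refine ⟨⟨Nat.mul_pos hb h1, ?_⟩, sqfullPart_eq_of_decomposition hb h1 hbfull hsq hcop.symm⟩
    exact (Nat.mul_le_mul_left b h2).trans (Nat.mul_div_le X b)
  · intro n hn
    rw [Finset.mem_filter] at hn
    have hdvd : b ∣ n := hn.2 ▸ sqfullPart_dvd n
    exact Nat.mul_div_cancel' hdvd
  · intro n' _
    exact Nat.mul_div_cancel_left n' hb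
  · intro n hn
    rw [Finset.mem_filter] at hn
    have hdvd : b ∣ n := hn.2 ▸ sqfullPart_dvd n
    rw [Nat.mul_div_cancel' hdvd]

/-- **Cauchy–Schwarz with weights**: `‖∑ u_i‖² ≤ (∑ w_i⁻¹)(∑ w_i ‖u_i‖²)` for positive weights.
[folklore] -/
theorem norm_sum_sq_le_weighted {ι : Type*} (T : Finset ι) (u : ι → ℂ) (w : ι → ℝ)
    (hw : ∀ i ∈ T, 0 < w i) :
    ‖∑ i ∈ T, u i‖ ^ 2 ≤ (∑ i ∈ T, (w i)⁻¹) * ∑ i ∈ T, w i * ‖u i‖ ^ 2 := by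
  have h1 : ‖∑ i ∈ T, u i‖ ≤ ∑ i ∈ T, Real.sqrt ((w i)⁻¹) * (Real.sqrt (w i) * ‖u i‖) := by
    refine (norm_sum_le _ _).trans (le_of_eq (Finset.sum_congr rfl fun i hi => ?_))
    rw [← mul_assoc, ← Real.sqrt_mul (inv_nonneg.mpr (hw i hi).le), inv_mul_cancel₀ (hw i hi).ne',
      Real.sqrt_one, one_mul]
  have h2 := Finset.sum_mul_sq_le_sq_mul_sq T (fun i => Real.sqrt ((w i)⁻¹))
    (fun i => Real.sqrt (w i) * ‖u i‖)
  have h3 : ∑ i ∈ T, Real.sqrt ((w i)⁻¹) ^ 2 = ∑ i ∈ T, (w i)⁻¹ :=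
    Finset.sum_congr rfl fun i hi => Real.sq_sqrt (inv_nonneg.mpr (hw i hi).le)
  have h4 : ∑ i ∈ T, (Real.sqrt (w i) * ‖u i‖) ^ 2 = ∑ i ∈ T, w i * ‖u i‖ ^ 2 :=
    Finset.sum_congr rfl fun i hi => by rw [mul_pow, Real.sq_sqrt (hw i hi).le]
  rw [h3, h4] at h2
  have h0 : 0 ≤ ∑ i ∈ T, Real.sqrt ((w i)⁻¹) * (Real.sqrt (w i) * ‖u i‖) :=
    Finset.sum_nonneg fun i _ => by positivity
  calc ‖∑ i ∈ T, u i‖ ^ 2 ≤ (∑ i ∈ T, Real.sqrt ((w i)⁻¹) * (Real.sqrt (w i) * ‖u i‖)) ^ 2 :=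
        pow_le_pow_left₀ (norm_nonneg _) h1 2
    _ ≤ _ := h2

/-- **Bettin–Chandee §6, the Cauchy–Schwarz over the squarefull part**: for any `c`,
`|∑_{n ≤ X} c(n)|² ≤ (∑_{b ≤ X sqfull} b^{-1/2}) · ∑_{b ≤ X sqfull} b^{1/2} |∑_{n' ≤ X/b, μ²(n')=1, (n',b)=1} c(b n')|²`
("We write `n = bn'` … We have `|∑ …|² ≪ (∑_b b^{-1/2})(∑_b b^{1/2} |∑_{n'} μ(n')² …|²)`").
[cite: BettinChandee2018, §6] -/
theorem BC_norm_sum_sq_le_sqfull (X : ℕ) (c : ℕ → ℂ) :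
    ‖∑ n ∈ Icc 1 X, c n‖ ^ 2 ≤
      (∑ b ∈ (Icc 1 X).filter (fun b => ∀ p ∈ b.primeFactors, p ^ 2 ∣ b), (Real.sqrt b)⁻¹) *
        ∑ b ∈ (Icc 1 X).filter (fun b => ∀ p ∈ b.primeFactors, p ^ 2 ∣ b),
          Real.sqrt b * ‖∑ n' ∈ (Icc 1 (X / b)).filter (fun n' => Squarefree n' ∧ n'.Coprime b),
            c (b * n')‖ ^ 2 := by
  set SF := (Icc 1 X).filter (fun b => ∀ p ∈ b.primeFactors, p ^ 2 ∣ b) with hSF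
  have hw : ∀ b ∈ SF, 0 < Real.sqrt b := by
    intro b hb
    rw [hSF, Finset.mem_filter, Finset.mem_Icc] at hb
    exact Real.sqrt_pos.mpr (by exact_mod_cast hb.1.1)
  have h1 := sum_Icc_eq_sum_sqfullPart_fiber X c
  have h2 := norm_sum_sq_le_weighted SF
    (fun b => ∑ n ∈ (Icc 1 X).filter (fun n => sqfullPart n = b), c n) (fun b => Real.sqrt b) hw
  have h3 : ∀ b ∈ SF, (∑ n ∈ (Icc 1 X).filter (fun n => sqfullPart n = b), c n) =
      ∑ n' ∈ (Icc 1 (X / b)).filter (fun n' => Squarefree n' ∧ n'.Coprime b), c (b * n') := by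
    intro b hb
    rw [hSF, Finset.mem_filter, Finset.mem_Icc] at hb
    exact sum_sqfullPart_fiber_eq X hb.1.1 hb.2 c
  rw [h1]
  refine h2.trans (le_of_eq ?_)
  congr 1
  exact Finset.sum_congr rfl fun b hb => by rw [h3 b hb]

/-- **Bettin–Chandee §6 for the second moment, general phase**: for any `β_n` and any function
`φ(m, n)`,
`∑_{m ≤ Y} |∑_{n ≤ X, (m,n)=1} β_n φ(m,n)|²
   ≤ Z(X) · ∑_{b ≤ X sqfull} b^{1/2} ∑_{m ≤ Y, (m,b)=1} |∑_{n' ≤ X/b, (n',m)=1} β_b(n') φ(m, b n')|²`,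
`β_b(n') = μ²(n') [(n',b)=1] β_{bn'}`, `Z(X) = ∑_{b ≤ X sqfull} b^{-1/2}` — the display
"`𝓒₁ = ∑_m |∑ …|² ≪ ∑_b b^{1/2} ∑_{(m,b)=1} |∑_{n' ∈ 𝓝_b,(bϑm,n')=1} μ(n')² β_{bn'} …|² = ∑_b b^{1/2} 𝓒_b(M, N/b; β_b)`"
of the source, for an arbitrary phase (so that it also serves the twisted sums of Remark 2).
[cite: BettinChandee2018, §6] -/
theorem BC_second_moment_le_sqfull (Y X : ℕ) (β : ℕ → ℂ) (φ : ℕ → ℕ → ℂ) :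
    ∑ m ∈ Icc 1 Y, ‖∑ n ∈ Icc 1 X, (if m.Coprime n then β n * φ m n else 0)‖ ^ 2 ≤
      (∑ b ∈ (Icc 1 X).filter (fun b => ∀ p ∈ b.primeFactors, p ^ 2 ∣ b), (Real.sqrt b)⁻¹) *
        ∑ b ∈ (Icc 1 X).filter (fun b => ∀ p ∈ b.primeFactors, p ^ 2 ∣ b),
          Real.sqrt b * ∑ m ∈ (Icc 1 Y).filter (fun m => m.Coprime b),
            ‖∑ n' ∈ (Icc 1 (X / b)).filter (fun n' => n'.Coprime m),
              (if Squarefree n' ∧ n'.Coprime b then β (b * n') else 0) * φ m (b * n')‖ ^ 2 := by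
  set SF := (Icc 1 X).filter (fun b => ∀ p ∈ b.primeFactors, p ^ 2 ∣ b) with hSF
  set Z : ℝ := ∑ b ∈ SF, (Real.sqrt b)⁻¹ with hZ
  -- for each `m`, the Cauchy–Schwarz over the squarefull part
  have hm : ∀ m : ℕ, ‖∑ n ∈ Icc 1 X, (if m.Coprime n then β n * φ m n else 0)‖ ^ 2 ≤
      Z * ∑ b ∈ SF, Real.sqrt b *
        ‖∑ n' ∈ (Icc 1 (X / b)).filter (fun n' => Squarefree n' ∧ n'.Coprime b),
          (if m.Coprime (b * n') then β (b * n') * φ m (b * n') else 0)‖ ^ 2 :=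
    fun m => BC_norm_sum_sq_le_sqfull X (fun n => if m.Coprime n then β n * φ m n else 0)
  -- the inner sums, rewritten
  have hinner : ∀ b ∈ SF, ∀ m : ℕ,
      (∑ n' ∈ (Icc 1 (X / b)).filter (fun n' => Squarefree n' ∧ n'.Coprime b),
          (if m.Coprime (b * n') then β (b * n') * φ m (b * n') else 0)) =
        if m.Coprime b then
          ∑ n' ∈ (Icc 1 (X / b)).filter (fun n' => n'.Coprime m),
            (if Squarefree n' ∧ n'.Coprime b then β (b * n') else 0) * φ m (b * n')
        else 0 := by
    intro b _ m
    by_cases hmb : m.Coprime b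
    · rw [if_pos hmb, Finset.sum_filter, Finset.sum_filter]
      refine Finset.sum_congr rfl fun n' _ => ?_
      by_cases h1 : Squarefree n' ∧ n'.Coprime b
      · rw [if_pos h1, if_pos h1]
        by_cases h2 : n'.Coprime m
        · rw [if_pos h2, if_pos (Nat.Coprime.mul_right hmb h2.symm)]
        · rw [if_neg h2, if_neg (fun h => h2 (Nat.Coprime.coprime_mul_left_right h).symm)]
      · rw [if_neg h1, if_neg h1]
        split_ifs <;> simp
    · rw [if_neg hmb]
      refine Finset.sum_eq_zero fun n' _ => ?_
      rw [if_neg (fun h => hmb (Nat.Coprime.coprime_mul_right_right h))]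
  calc ∑ m ∈ Icc 1 Y, ‖∑ n ∈ Icc 1 X, (if m.Coprime n then β n * φ m n else 0)‖ ^ 2
      ≤ ∑ m ∈ Icc 1 Y, Z * ∑ b ∈ SF, Real.sqrt b *
          ‖∑ n' ∈ (Icc 1 (X / b)).filter (fun n' => Squarefree n' ∧ n'.Coprime b),
            (if m.Coprime (b * n') then β (b * n') * φ m (b * n') else 0)‖ ^ 2 :=
        Finset.sum_le_sum fun m _ => hm m
    _ = Z * ∑ b ∈ SF, Real.sqrt b * ∑ m ∈ Icc 1 Y,
          ‖∑ n' ∈ (Icc 1 (X / b)).filter (fun n' => Squarefree n' ∧ n'.Coprime b),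
            (if m.Coprime (b * n') then β (b * n') * φ m (b * n') else 0)‖ ^ 2 := by
        rw [← Finset.mul_sum, Finset.sum_comm]
        congr 1
        refine Finset.sum_congr rfl fun b _ => ?_
        rw [Finset.mul_sum]
    _ = Z * ∑ b ∈ SF, Real.sqrt b * ∑ m ∈ (Icc 1 Y).filter (fun m => m.Coprime b),
          ‖∑ n' ∈ (Icc 1 (X / b)).filter (fun n' => n'.Coprime m),
            (if Squarefree n' ∧ n'.Coprime b then β (b * n') else 0) * φ m (b * n')‖ ^ 2 := by
        congr 1
        refine Finset.sum_congr rfl fun b hb => ?_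
        congr 1
        rw [Finset.sum_filter]
        refine Finset.sum_congr rfl fun m _ => ?_
        rw [hinner b hb m]
        split_ifs <;> simp

/-! ### The number of squarefull integers: `∑_{b ≤ X squarefull} b^{-1/2} ≪ X^ε` -/

/-- A positive squarefull number is `d² a` with `a ∣ d` (write `b = d² a`, `a` squarefree; every
prime factor of `a` divides `d`). [folklore] -/
theorem exists_sq_mul_dvd_of_sqfull {b : ℕ} (hb : 0 < b) (hbfull : ∀ p ∈ b.primeFactors, p ^ 2 ∣ b) :
    ∃ d a : ℕ, 0 < d ∧ 0 < a ∧ a ∣ d ∧ d ^ 2 * a = b := by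
  obtain ⟨a, d, ha0, hd0, hda, hsq⟩ := Nat.sq_mul_squarefree_of_pos hb
  have hdvd : ∀ p ∈ a.primeFactors, p ∣ d := by
    intro p hp
    have hpp := Nat.prime_of_mem_primeFactors hp
    have hpa : p ∣ a := Nat.dvd_of_mem_primeFactors hp
    have hpb : p ∈ b.primeFactors := by
      rw [Nat.mem_primeFactors]
      exact ⟨hpp, hpa.trans ⟨d ^ 2, by rw [← hda]; ring⟩, hb.ne'⟩
    have hp2 : p ^ 2 ∣ d ^ 2 * a := by rw [hda]; exact hbfull p hpb
    by_contra hpd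
    have hcop : Nat.Coprime (p ^ 2) (d ^ 2) :=
      (Nat.Coprime.pow_left 2 ((Nat.Prime.coprime_iff_not_dvd hpp).mpr hpd)).pow_right 2
    have hp2a : p ^ 2 ∣ a := hcop.dvd_of_dvd_mul_left hp2
    rw [pow_two] at hp2a
    exact hpp.one_lt.ne' (Nat.isUnit_iff.mp (hsq p hp2a))
  have had : a ∣ d := by
    rw [← Nat.prod_primeFactors_of_squarefree hsq]
    exact Finset.prod_primes_dvd d (fun p hp => Nat.prime_iff.mp (Nat.prime_of_mem_primeFactors hp))
      hdvd
  exact ⟨d, a, hd0, ha0, had, hda⟩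

/-- **`∑_{b ≤ X squarefull} b^{-1/2} ≤ C_ε X^ε`** for `X ≥ 1` (each squarefull `b ≤ X` is `d² a` with
`a ∣ d ≤ √X`, so the sum is at most `∑_{d ≤ √X} τ(d)/d ≤ C (√X)^{ε} (1 + log √X)`).
(The source only needs `≪ M^ε`.) [cite: BettinChandee2018, §6] -/
theorem sum_sqfull_inv_sqrt_le {ε : ℝ} (hε : 0 < ε) :
    ∃ C : ℝ, 0 < C ∧ ∀ X : ℕ, 0 < X →
      ∑ b ∈ (Icc 1 X).filter (fun b => ∀ p ∈ b.primeFactors, p ^ 2 ∣ b), (Real.sqrt b)⁻¹ ≤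
        C * (X : ℝ) ^ ε := by
  obtain ⟨C₁, hC₁1, hC₁⟩ :=
    Literature.NumberTheory.Sieve.exists_card_divisors_le_mul_rpow (ε := ε / 2) (by positivity)
  refine ⟨C₁ * (1 + 2 / ε), by positivity, ?_⟩
  intro X hX
  set SF := (Icc 1 X).filter (fun b => ∀ p ∈ b.primeFactors, p ^ 2 ∣ b) with hSF
  -- choose the decomposition `b = d(b)² a(b)`, `a(b) ∣ d(b)`
  have hdec : ∀ b ∈ SF, ∃ d a : ℕ, 0 < d ∧ 0 < a ∧ a ∣ d ∧ d ^ 2 * a = b := by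
    intro b hb
    rw [hSF, Finset.mem_filter, Finset.mem_Icc] at hb
    exact exists_sq_mul_dvd_of_sqfull hb.1.1 hb.2
  choose! d a hd ha had hdab using hdec
  set D : ℕ := Nat.sqrt X with hD
  have hD0 : 0 < D := Nat.sqrt_pos.mpr hX
  -- `d(b) ≤ √X` and `b^{-1/2} ≤ 1/d(b)`
  have hmaps : ∀ b ∈ SF, d b ∈ Icc 1 D := by
    intro b hb
    rw [Finset.mem_Icc]
    refine ⟨hd b hb, ?_⟩
    rw [hD, Nat.le_sqrt']
    have h1 : d b ^ 2 ≤ b := by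
      calc d b ^ 2 = d b ^ 2 * 1 := (mul_one _).symm
        _ ≤ d b ^ 2 * a b := Nat.mul_le_mul_left _ (ha b hb)
        _ = b := hdab b hb
    have h2 : b ≤ X := (Finset.mem_Icc.mp (Finset.mem_filter.mp hb).1).2
    exact h1.trans h2
  have hterm : ∀ b ∈ SF, (Real.sqrt b)⁻¹ ≤ ((d b : ℕ) : ℝ)⁻¹ := by
    intro b hb
    have hdb : (0 : ℝ) < d b := by exact_mod_cast hd b hb
    refine inv_anti₀ hdb ?_
    rw [show ((d b : ℕ) : ℝ) = Real.sqrt (((d b : ℕ) : ℝ) ^ 2) by rw [Real.sqrt_sq hdb.le]]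
    refine Real.sqrt_le_sqrt ?_
    have h1 : d b ^ 2 ≤ b := by
      calc d b ^ 2 = d b ^ 2 * 1 := (mul_one _).symm
        _ ≤ d b ^ 2 * a b := Nat.mul_le_mul_left _ (ha b hb)
        _ = b := hdab b hb
    exact_mod_cast h1
  -- the fibre over `d₀` has at most `τ(d₀)` elements (`b ↦ a(b) ∣ d₀` is injective)
  have hfiber : ∀ d₀ ∈ Icc 1 D, ((SF.filter (fun b => d b = d₀)).card : ℝ) ≤ (d₀.divisors.card : ℝ) := by
    intro d₀ hd₀
    have hd₀0 : d₀ ≠ 0 := by have := (Finset.mem_Icc.mp hd₀).1; omega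
    exact_mod_cast Finset.card_le_card_of_injOn a
      (fun b hb => by
        rw [Finset.mem_coe, Finset.mem_filter] at hb
        rw [Finset.mem_coe, Nat.mem_divisors]
        exact ⟨hb.2 ▸ had b hb.1, hd₀0⟩)
      (fun b₁ hb₁ b₂ hb₂ hab => by
        rw [Finset.mem_coe, Finset.mem_filter] at hb₁ hb₂
        have e1 := hdab b₁ hb₁.1
        have e2 := hdab b₂ hb₂.1
        rw [hb₁.2] at e1
        rw [hb₂.2] at e2
        rw [← e1, ← e2, hab])
  -- assemble
  have hXr : (1 : ℝ) ≤ X := by exact_mod_cast hX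
  have hDX : (D : ℝ) ≤ X := by exact_mod_cast Nat.sqrt_le_self X
  have hD1 : (1 : ℝ) ≤ D := by exact_mod_cast hD0
  calc ∑ b ∈ SF, (Real.sqrt b)⁻¹ ≤ ∑ b ∈ SF, ((d b : ℕ) : ℝ)⁻¹ := Finset.sum_le_sum hterm
    _ = ∑ d₀ ∈ Icc 1 D, ∑ b ∈ SF.filter (fun b => d b = d₀), ((d b : ℕ) : ℝ)⁻¹ :=
        (Finset.sum_fiberwise_of_maps_to hmaps _).symm
    _ = ∑ d₀ ∈ Icc 1 D, ((SF.filter (fun b => d b = d₀)).card : ℝ) * ((d₀ : ℕ) : ℝ)⁻¹ := by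
        refine Finset.sum_congr rfl fun d₀ _ => ?_
        rw [Finset.sum_congr rfl fun b hb => by rw [(Finset.mem_filter.mp hb).2], Finset.sum_const,
          nsmul_eq_mul]
    _ ≤ ∑ d₀ ∈ Icc 1 D, (C₁ * (D : ℝ) ^ (ε / 2)) * ((d₀ : ℕ) : ℝ)⁻¹ := by
        refine Finset.sum_le_sum fun d₀ hd₀ => ?_
        have hd₀1 : 1 ≤ d₀ := (Finset.mem_Icc.mp hd₀).1
        have hd₀D : (d₀ : ℝ) ≤ D := by exact_mod_cast (Finset.mem_Icc.mp hd₀).2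
        gcongr
        calc ((SF.filter (fun b => d b = d₀)).card : ℝ) ≤ (d₀.divisors.card : ℝ) := hfiber d₀ hd₀
          _ ≤ C₁ * (d₀ : ℝ) ^ (ε / 2) := hC₁ d₀ (by omega)
          _ ≤ C₁ * (D : ℝ) ^ (ε / 2) := by gcongr
    _ = C₁ * (D : ℝ) ^ (ε / 2) * ∑ d₀ ∈ Icc 1 D, ((d₀ : ℕ) : ℝ)⁻¹ := by rw [Finset.mul_sum]
    _ ≤ C₁ * (D : ℝ) ^ (ε / 2) * (1 + Real.log D) := by
        gcongr
        have h := harmonic_le_one_add_log D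
        have e : (∑ d₀ ∈ Icc 1 D, ((d₀ : ℕ) : ℝ)⁻¹) = (harmonic D : ℝ) := by
          rw [harmonic_eq_sum_Icc]; push_cast; rfl
        rw [e]; exact h
    _ ≤ C₁ * (D : ℝ) ^ (ε / 2) * ((1 + 2 / ε) * (D : ℝ) ^ (ε / 2)) := by
        gcongr
        -- `1 + log D ≤ (1 + 1/(ε/2)) D^{ε/2}`
        have h3 : Real.log D ≤ (D : ℝ) ^ (ε / 2) / (ε / 2) :=
          Real.log_le_rpow_div (by positivity) (by positivity)
        have h4 : (1 : ℝ) ≤ (D : ℝ) ^ (ε / 2) := Real.one_le_rpow hD1 (by positivity)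
        calc 1 + Real.log D ≤ (D : ℝ) ^ (ε / 2) + (D : ℝ) ^ (ε / 2) / (ε / 2) := add_le_add h4 h3
          _ = (1 + 2 / ε) * (D : ℝ) ^ (ε / 2) := by field_simp
    _ = C₁ * (1 + 2 / ε) * ((D : ℝ) ^ (ε / 2) * (D : ℝ) ^ (ε / 2)) := by ring
    _ = C₁ * (1 + 2 / ε) * (D : ℝ) ^ ε := by
        rw [← Real.rpow_add (by positivity)]; ring_nf
    _ ≤ C₁ * (1 + 2 / ε) * (X : ℝ) ^ ε := by gcongr

/-- **`𝓒₁ ≤ Z · ∑_b b^{1/2} 𝓒_b(M, N/b; β_b)`** in the tree's notation `kfC` (the untwisted second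
moment of Duke–Friedlander–Iwaniec / Bettin–Chandee, `KloostermanFractionsAmplifiedForm.lean`):
for `N ≥ 0`, any `k`, `M` and `β`,
`∑_{m ≤ 2M} |∑_{n ≤ 2N,(m,n)=1} β_n e(k m̄/n)|² ≤ Z(⌊2N⌋) ∑_{b ≤ 2N sqfull} b^{1/2} kfC k b M (N/b) β_b`,
`β_b(n') = μ²(n') [(n',b)=1] β_{bn'}`, `Z(X) = ∑_{b ≤ X sqfull} b^{-1/2}` (`≤ C_ε X^ε`,
`sum_sqfull_inv_sqrt_le`). [cite: BettinChandee2018, §6] -/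
theorem BC_C1_le_sum_sqfull_kfC (k : ℤ) (M N : ℝ) (β : ℕ → ℂ) :
    ∑ m ∈ Icc 1 ⌊2 * M⌋₊, ‖∑ n ∈ Icc 1 ⌊2 * N⌋₊,
        (if m.Coprime n then
          β n * Complex.exp (2 * Real.pi * Complex.I *
            ((k : ℂ) * ((((m : ZMod n)⁻¹).val : ℕ) : ℂ) / (n : ℂ)))
        else 0)‖ ^ 2 ≤
      (∑ b ∈ (Icc 1 ⌊2 * N⌋₊).filter (fun b => ∀ p ∈ b.primeFactors, p ^ 2 ∣ b), (Real.sqrt b)⁻¹) *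
        ∑ b ∈ (Icc 1 ⌊2 * N⌋₊).filter (fun b => ∀ p ∈ b.primeFactors, p ^ 2 ∣ b),
          Real.sqrt b * kfC k b M (N / b) (fun n' => if Squarefree n' ∧ n'.Coprime b then β (b * n') else 0) := by
  have h := BC_second_moment_le_sqfull ⌊2 * M⌋₊ ⌊2 * N⌋₊ β (fun m n => kfPhase k n m)
  have hfl : ∀ b : ℕ, ⌊2 * (N / b)⌋₊ = ⌊2 * N⌋₊ / b := fun b => by
    rw [show (2 : ℝ) * (N / b) = 2 * N / b by ring, Nat.floor_div_natCast]
  refine (le_of_eq rfl).trans (h.trans (le_of_eq ?_))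
  congr 1
  refine Finset.sum_congr rfl fun b _ => ?_
  congr 1
  unfold kfC kfInner kfCoeff
  rw [hfl b]

/-- The same for the **twisted** second moment (the phase `e(k m̄/n + X/(mn))` of Bettin–Chandee's
Remark 2 / the named fact `DukeFriedlanderIwaniec1997_bilinearKloostermanFractions`):
`∑_{m ≤ 2M} |∑_{n ≤ 2N,(m,n)=1} β_n e(k m̄/n + X/mn)|²
  ≤ Z(⌊2N⌋) ∑_{b ≤ 2N sqfull} b^{1/2} ∑_{m ≤ 2M,(m,b)=1} |∑_{n' ≤ 2N/b,(n',m)=1} β_b(n') e(k m̄/(bn') + X/(m b n'))|²`.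
[cite: BettinChandee2018, §6 and Remark 2] -/
theorem BC_C1_twisted_le_sum_sqfull (k : ℤ) (X : ℝ) (M N : ℝ) (β : ℕ → ℂ) :
    ∑ m ∈ Icc 1 ⌊2 * M⌋₊, ‖∑ n ∈ Icc 1 ⌊2 * N⌋₊,
        (if m.Coprime n then
          β n * Complex.exp (2 * Real.pi * Complex.I *
            ((k : ℂ) * ((((m : ZMod n)⁻¹).val : ℕ) : ℂ) / (n : ℂ) + (X : ℂ) / ((m : ℂ) * n)))
        else 0)‖ ^ 2 ≤
      (∑ b ∈ (Icc 1 ⌊2 * N⌋₊).filter (fun b => ∀ p ∈ b.primeFactors, p ^ 2 ∣ b), (Real.sqrt b)⁻¹) *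
        ∑ b ∈ (Icc 1 ⌊2 * N⌋₊).filter (fun b => ∀ p ∈ b.primeFactors, p ^ 2 ∣ b),
          Real.sqrt b * ∑ m ∈ (Icc 1 ⌊2 * M⌋₊).filter (fun m => m.Coprime b),
            ‖∑ n' ∈ (Icc 1 ⌊2 * (N / b)⌋₊).filter (fun n' => n'.Coprime m),
              (if Squarefree n' ∧ n'.Coprime b then β (b * n') else 0) *
                Complex.exp (2 * Real.pi * Complex.I *
                  ((k : ℂ) * ((((m : ZMod (b * n'))⁻¹).val : ℕ) : ℂ) / ((b * n' : ℕ) : ℂ) +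
                    (X : ℂ) / ((m : ℂ) * ((b * n' : ℕ) : ℂ))))‖ ^ 2 := by
  have h := BC_second_moment_le_sqfull ⌊2 * M⌋₊ ⌊2 * N⌋₊ β (fun m n => Complex.exp (2 * Real.pi *
    Complex.I * ((k : ℂ) * ((((m : ZMod n)⁻¹).val : ℕ) : ℂ) / (n : ℂ) + (X : ℂ) / ((m : ℂ) * n))))
  have hfl : ∀ b : ℕ, ⌊2 * (N / b)⌋₊ = ⌊2 * N⌋₊ / b := fun b => by
    rw [show (2 : ℝ) * (N / b) = 2 * N / b by ring, Nat.floor_div_natCast]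
  refine (le_of_eq rfl).trans (h.trans (le_of_eq ?_))
  congr 1
  refine Finset.sum_congr rfl fun b _ => ?_
  rw [hfl b]

end Literature.NumberTheory.LFunctions

end
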